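import Summits.HodgeConjecture.HodgeConjecture.Theorems.F0P3HJ3aOfFourLetters
import Summits.HodgeConjecture.HodgeConjecture.Theorems.F0P3HolProjectionOfF2
import HarnessLib

/-!
# Crux `H413` — `hJ3a` (row III-J3a) and `H413` FROM THREE ROGAWSKI LETTERS {E1, E1′hol, E2′} + THE REGULARITY LETTER F2: letter (D)hol
# `CotangentForms.holCotFormSpectralProjection` is folded BY NAME into F2

Floor-0 programme P3 «U3-mult», seat F0P3-p02 (g3); crux item stmt-HodgeConjecture-24833 (`HCCMUnconditional.H413`); line
`Cruxes/H413/Lines/F0_U3CohMultOne.lean` (HEAD 3′/3″ chain `hJ3a_of_five_letters` → ★ `HJ3aOfFourLetters.hJ3a_of_four_letters`).  HC_CM is proved only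
modulo the printed citations until rung 0 closes.  THEOREMS ONLY (no definition, no named fact, no `sorry`).

The four-letter head ★ `HJ3aOfFourLetters.hJ3a_of_four_letters` (F0P3-p04 (g3), p798129) takes (D)hol = the Literature letter
`UnitaryGroup.CotangentForms.holCotFormSpectralProjection` («the spectral projection of the pair of classes of a holomorphic cotangent form is the pair
of classes of a holomorphic cotangent form») as a hypothesis.  ★ `F0P3HolProjectionOfF2.holCotFormSpectralProjection_of_F2` (F0P3-p02 (g3), p798221;
ENGINE-INTERFACES §7j «(D)h at rung 1 = F2 alone») derives that letter from the GENERAL regularity letter F2 ★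
`DiscreteAutomorphicRep.KFiniteSmoothRepresentative` («`K`-finite vectors of a discrete automorphic representation on a compact quotient, fixed by a compact
`U` commuting with the archimedean factor, are classes of smooth automorphic forms», [Borel1997, Thm. 2.13–2.14]; [BorelJacquet1979, §4.3, §4.6]) taken
at every CM frame `(L, ι, H, T, hT)` along `(BallForms.u21Group, cmArchSection)`.  This file substitutes it: row III-J3a and the crux are theorems modulo
the THREE Rogawski letters E1 `Rogawski1990.innerFormMultiplicityLeOne`, E1′hol `Rogawski1990.cohFinComponentUnique_hol`, E2′ `Rogawski1990.hodgeTypeRigid`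
and F2 (hypothesis `hF2`, the ∀-CM-frame instance of the named fact, verbatim the hypothesis of `holCotFormSpectralProjection_of_F2`).  Conclusions
VERBATIM as in `F0P3HJ3aOfFourLetters`.  (Programme P2's line `F0_P2SpectralProjectionD` is about to make (D)hol an unconditional theorem — stubs K∕H∕G∕T∕R ★,
S filed; when its head lands, `hJ3a_of_four_letters` applies to it directly and F2 leaves this head too.)

References: [Liu2021] Prop. 4.13 and proof l. 2121–2146, Lem. D.2 (2); [Rogawski1990] Thm. 14.6.4, §15.3 ¶1, Prop. 15.2.1 (b);
[Borel1997] Thm. 2.13–2.14; [BorelJacquet1979] §4.3, §4.6; [BorelWallach2000] VI 4.11, VII 3.2.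
-/

-- the mandated namespace repeats `HodgeConjecture.HodgeConjecture`, as in every `Theorems/*.lean` of this sub-problem
set_option linter.dupNamespace false

noncomputable section

namespace Summit.HodgeConjecture.HodgeConjecture.Cruxes.H413.HJ3aOfThreeLettersF2

open scoped TensorProduct Matrix
open NumberField NumberField.InfinitePlace IsDedekindDomain
open HodgeCM.Model HodgeCM.Model.LiuIndex HodgeCM.Model.TowerCarrier
open Summit.HodgeConjecture.CorCM.Model
open Literature.AlgebraicGeometry.Motives (CMType AbelianVariety)
open Literature.AlgebraicGeometry.HodgeTheory Literature.NumberTheory.Automorphic.PicardCM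
open Literature.AlgebraicGeometry.ShimuraVarieties Literature.AlgebraicGeometry.ShimuraVarieties.UnitaryCanonicalModel
open Literature.NumberTheory.ComplexMultiplication
open Literature.NumberTheory.Automorphic
open Literature.NumberTheory.Automorphic.Liu2021 Literature.NumberTheory.Automorphic.Liu2021.AppendixC
open Literature.NumberTheory.Automorphic.Liu2021.Def411WeilCarriers (lineOf locF Rep)
open Summit.HodgeConjecture.CorCM.Transposition.OmegaTransport (realUnit)
open HodgeCM.Model.ArchSideTerm (e₁)
open Literature.NumberTheory.GelbartRogawski1991 Literature.NumberTheory.GelbartRogawski1991.UnitaryDualPair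
open Literature.RepresentationTheory Literature.RepresentationTheory.Liu2021
open Summit.HodgeConjecture.CorCM
open Summit.HodgeConjecture.CorCM.Transposition
open Literature.NumberTheory.GelbartRogawski1991.OscillatorTripleDictionary (OccursInH1 IsIsoToOmega)
open Summit.HodgeConjecture.CorCM.Lines.A3Liu418 (Thm415AtFace EpsRigidAtFace)
open Summit.HodgeConjecture.HodgeConjecture.Theses (HCCMUnconditional.HDel)
open MulAction
open Literature.Geometry.ComplexHyperbolic.BallModel (U21 x₀)
open Literature.NumberTheory.GelbartRogawski1991.OscillatorTripleDictionary (rhoTriple)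
open Summit.HodgeConjecture.CorCM.Lines.A3Liu413 (datum413)
open Summit.HodgeConjecture.HodgeConjecture.Cruxes.H413.CohFormsCarriers

set_option synthInstance.maxHeartbeats 400000 in
set_option maxHeartbeats 8000000 in
/-- **`hJ3a` FROM THREE ROGAWSKI LETTERS {E1, E1′hol, E2′} AND THE REGULARITY LETTER F2** (row III-J3a of the floor: `rank_ℂ Hom_{U(V)(𝔸_{F⁺,f})}(ω_V(t),
H¹_{B,τ'}) ≤ 1` for every face, `3 ≤ n`, `τ'`, `t`); conclusion = floor V7 ll. 76–80 VERBATIM.  (D)hol := ★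
`F0P3HolProjectionOfF2.holCotFormSpectralProjection_of_F2 hF2` (F2 = ★ `DiscreteAutomorphicRep.KFiniteSmoothRepresentative` at every CM frame), the rest = ★
`HJ3aOfFourLetters.hJ3a_of_four_letters`.  HC_CM is proved only modulo the printed citations until rung 0 closes.
[cite: Liu2021, proof of Prop. 4.13, l. 2121–2146; Lem. D.2 (2)] [cite: Rogawski1990, Thm. 14.6.4; §15.3 ¶1] [cite: Borel1997, Thm. 2.13 and 2.14]
[cite: BorelJacquet1979, §4.3 and §4.6] -/
theorem hJ3a_of_three_letters_F2 (hE1 : Literature.NumberTheory.Rogawski1990.innerFormMultiplicityLeOne)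
    (hE1'h : Literature.NumberTheory.Rogawski1990.cohFinComponentUnique_hol)
    (hE2' : Literature.NumberTheory.Rogawski1990.hodgeTypeRigid)
    (hF2 : ∀ (L : Type) [Field L] [NumberField L] [IsCMField L] (ι : L →+* ℂ) (H : Matrix (Fin 3) (Fin 3) L) (T : GL (Fin 3) ℂ)
      (hT : (T : Matrix (Fin 3) (Fin 3) ℂ)ᴴ * H.map ι * (T : Matrix (Fin 3) (Fin 3) ℂ) = Literature.Geometry.ComplexHyperbolic.BallModel.J)
      (μ : MeasureTheory.Measure (UnitaryGroup.adelicGroupData (↥(maximalRealSubfield L)) L (IsCMField.complexConj L) 3 H).automorphicQuotient)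
      [(UnitaryGroup.adelicGroupData (↥(maximalRealSubfield L)) L (IsCMField.complexConj L) 3 H).IsAutomorphicMeasure μ]
      (P : DiscreteAutomorphicRep (UnitaryGroup.adelicGroupData (↥(maximalRealSubfield L)) L (IsCMField.complexConj L) 3 H) μ),
      P.KFiniteSmoothRepresentative BallForms.u21Group (UnitaryGroup.CotangentForms.cmArchSection L ι H T hT)) :
    ∀ (hDel : Literature.AlgebraicGeometry.ShimuraVarieties.UnitaryCanonicalModel.canonicalModel_exists_printed)
    (F : HodgeCM.CMField) [IsGalois ℚ F] (h6 : 6 ≤ Module.finrank ℚ F) {ι₁ : F →+* ℂ} (V : HodgeCM.HermSpace3 F ι₁) (a₀ : RealScalar F)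
    (Φ : CMType F) (hΦ : ι₁ ∈ Φ.1) (i : (I V (repAt a₀) (muLiu ι₁ GramClass.rep))),
    (((uniformOmegaRep (Summit.HodgeConjecture.CorCM.DelRec.exists_recordSystem_of_printed hDel) ⟨HodgeCM.CMField.K F⟩ ι₁ ⟨HodgeCM.HermSpace3.Hm V, HodgeCM.HermSpace3.isHermitian V, HodgeCM.HermSpace3.signature_ι₁ V, HodgeCM.HermSpace3.posDef_of_ne V⟩ Φ e₁ (frameD V) (frameD_real V) (frameD_ne V) (ιVE V) (2 * imagUnit (HodgeCM.CMField.K F))⁻¹ (fun _ _ => (Rep.update ↥(maximalRealSubfield (HodgeCM.CMField.K F)) (imagUnitSq (HodgeCM.CMField.K F)) (Rep.ofLineOf ↥(maximalRealSubfield (HodgeCM.CMField.K F)) (imagUnitSq (HodgeCM.CMField.K F))) (locF ↥(maximalRealSubfield (HodgeCM.CMField.K F)) (imagUnitSq (HodgeCM.CMField.K F)) (realUnit ⟨HodgeCM.CMField.K F⟩ (repAt a₀ (Sigma.fst i)).1 (repAt a₀ (Sigma.fst i)).2.1 (repAt a₀ (Sigma.fst i)).2.2)) (realUnit ⟨HodgeCM.CMField.K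 F⟩ (repAt a₀ (Sigma.fst i)).1 (repAt a₀ (Sigma.fst i)).2.1 (repAt a₀ (Sigma.fst i)).2.2) rfl)))).prop413Data ((liuDictionaryPin exists_isReal_hodgeModel_holds hodgePQ_independent_of_hodgeModel_holds BallQuotient.ballQuotientUniformised_holds (cmAbelianVarietyRealised_of_eigenbasis exists_isReal_hodgeModel_holds hodgePQ_independent_of_hodgeModel_holds cmAbelianVarietyEigenbasisRealised_holds) Literature.NumberTheory.Transcendental.arapura2012_cor_15_4_6_holds V (I V (repAt a₀) (muLiu ι₁ GramClass.rep)) (line V (repAt a₀) (muLiu ι₁ GramClass.rep)))).H).multiplicity_le_one_printed :=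
  HJ3aOfFourLetters.hJ3a_of_four_letters hE1 hE1'h hE2' (F0P3HolProjectionOfF2.holCotFormSpectralProjection_of_F2 hF2)

set_option synthInstance.maxHeartbeats 400000 in
set_option maxHeartbeats 8000000 in
/-- **THE CRUX `HCCMUnconditional.H413` BY NAME FROM THREE ROGAWSKI LETTERS, THE REGULARITY LETTER F2, AND THE TWO OTHER FLOOR ROWS** (`hdictE` = row
III-2 (a)′, `hocc` = row III-2 (c)′, VERBATIM as in `HJ3aOfFourLetters.H413_of_four_letters`). HC_CM is proved only modulo the printed citations until
rung 0 closes. [cite: Liu2021, Prop. 4.13; Rem. 4.14] [cite: Rogawski1990, Thm. 14.6.4; §15.3] [cite: Borel1997, Thm. 2.13 and 2.14] -/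
theorem H413_of_three_letters_F2 (hE1 : Literature.NumberTheory.Rogawski1990.innerFormMultiplicityLeOne)
    (hE1'h : Literature.NumberTheory.Rogawski1990.cohFinComponentUnique_hol)
    (hE2' : Literature.NumberTheory.Rogawski1990.hodgeTypeRigid)
    (hF2 : ∀ (L : Type) [Field L] [NumberField L] [IsCMField L] (ι : L →+* ℂ) (H : Matrix (Fin 3) (Fin 3) L) (T : GL (Fin 3) ℂ)
      (hT : (T : Matrix (Fin 3) (Fin 3) ℂ)ᴴ * H.map ι * (T : Matrix (Fin 3) (Fin 3) ℂ) = Literature.Geometry.ComplexHyperbolic.BallModel.J)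
      (μ : MeasureTheory.Measure (UnitaryGroup.adelicGroupData (↥(maximalRealSubfield L)) L (IsCMField.complexConj L) 3 H).automorphicQuotient)
      [(UnitaryGroup.adelicGroupData (↥(maximalRealSubfield L)) L (IsCMField.complexConj L) 3 H).IsAutomorphicMeasure μ]
      (P : DiscreteAutomorphicRep (UnitaryGroup.adelicGroupData (↥(maximalRealSubfield L)) L (IsCMField.complexConj L) 3 H) μ),
      P.KFiniteSmoothRepresentative BallForms.u21Group (UnitaryGroup.CotangentForms.cmArchSection L ι H T hT))
    (hdictE :
      ∀ (hDel : Literature.AlgebraicGeometry.ShimuraVarieties.UnitaryCanonicalModel.canonicalModel_exists_printed)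
      (F : HodgeCM.CMField) [IsGalois ℚ F] (h6 : 6 ≤ Module.finrank ℚ F) {ι₁ : F →+* ℂ} (V : HodgeCM.HermSpace3 F ι₁) (a₀ : RealScalar F)
      (Φ : CMType F) (hΦ : ι₁ ∈ Φ.1) (i : (I V (repAt a₀) (muLiu ι₁ GramClass.rep))),
      oscillatorTriple_dictionaryExistence (((uniformOmegaRep (Summit.HodgeConjecture.CorCM.DelRec.exists_recordSystem_of_printed hDel) ⟨HodgeCM.CMField.K F⟩ ι₁ ⟨HodgeCM.HermSpace3.Hm V, HodgeCM.HermSpace3.isHermitian V, HodgeCM.HermSpace3.signature_ι₁ V, HodgeCM.HermSpace3.posDef_of_ne V⟩ Φ e₁ (frameD V) (frameD_real V) (frameD_ne V) (ιVE V) (2 * imagUnit (HodgeCM.CMField.K F))⁻¹ (fun _ _ => (Rep.update ↥(maximalRealSubfield (HodgeCM.CMField.K F)) (imagUnitSq (HodgeCM.CMField.K F)) (Rep.ofLineOf ↥(maximalRealSubfield (HodgeCM.CMField.K F)) (imagUnitSq (HodgeCM.CMField.K F))) (locF ↥(maximalRealSubfield (HodgeCM.CMField.K F)) (imagUnitSq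 (HodgeCM.CMField.K F)) (realUnit ⟨HodgeCM.CMField.K F⟩ (repAt a₀ (Sigma.fst i)).1 (repAt a₀ (Sigma.fst i)).2.1 (repAt a₀ (Sigma.fst i)).2.2)) (realUnit ⟨HodgeCM.CMField.K F⟩ (repAt a₀ (Sigma.fst i)).1 (repAt a₀ (Sigma.fst i)).2.1 (repAt a₀ (Sigma.fst i)).2.2) rfl)))).prop413Data ((liuDictionaryPin exists_isReal_hodgeModel_holds hodgePQ_independent_of_hodgeModel_holds BallQuotient.ballQuotientUniformised_holds (cmAbelianVarietyRealised_of_eigenbasis exists_isReal_hodgeModel_holds hodgePQ_independent_of_hodgeModel_holds cmAbelianVarietyEigenbasisRealised_holds) Literature.NumberTheory.Transcendental.arapura2012_cor_15_4_6_holds V (I V (repAt a₀) (muLiu ι₁ GramClass.rep)) (line V (repAt a₀) (muLiu ι₁ GramClass.rep)))).H))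
    (hocc :
      ∀ (hDel : Literature.AlgebraicGeometry.ShimuraVarieties.UnitaryCanonicalModel.canonicalModel_exists_printed)
      (F : HodgeCM.CMField) [IsGalois ℚ F] (h6 : 6 ≤ Module.finrank ℚ F) {ι₁ : F →+* ℂ} (V : HodgeCM.HermSpace3 F ι₁) (a₀ : RealScalar F)
      (Φ : CMType F) (hΦ : ι₁ ∈ Φ.1) (i : (I V (repAt a₀) (muLiu ι₁ GramClass.rep))),
      admissible_occursInH1 (((uniformOmegaRep (Summit.HodgeConjecture.CorCM.DelRec.exists_recordSystem_of_printed hDel) ⟨HodgeCM.CMField.K F⟩ ι₁ ⟨HodgeCM.HermSpace3.Hm V, HodgeCM.HermSpace3.isHermitian V, HodgeCM.HermSpace3.signature_ι₁ V, HodgeCM.HermSpace3.posDef_of_ne V⟩ Φ e₁ (frameD V) (frameD_real V) (frameD_ne V) (ιVE V) (2 * imagUnit (HodgeCM.CMField.K F))⁻¹ (fun _ _ => (Rep.update ↥(maximalRealSubfield (HodgeCM.CMField.K F)) (imagUnitSq (HodgeCM.CMField.K F)) (Rep.ofLineOf ↥(maximalRealSubfield (HodgeCM.CMField.K F)) (imagUnitSq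 (HodgeCM.CMField.K F))) (locF ↥(maximalRealSubfield (HodgeCM.CMField.K F)) (imagUnitSq (HodgeCM.CMField.K F)) (realUnit ⟨HodgeCM.CMField.K F⟩ (repAt a₀ (Sigma.fst i)).1 (repAt a₀ (Sigma.fst i)).2.1 (repAt a₀ (Sigma.fst i)).2.2)) (realUnit ⟨HodgeCM.CMField.K F⟩ (repAt a₀ (Sigma.fst i)).1 (repAt a₀ (Sigma.fst i)).2.1 (repAt a₀ (Sigma.fst i)).2.2) rfl)))).prop413Data ((liuDictionaryPin exists_isReal_hodgeModel_holds hodgePQ_independent_of_hodgeModel_holds BallQuotient.ballQuotientUniformised_holds (cmAbelianVarietyRealised_of_eigenbasis exists_isReal_hodgeModel_holds hodgePQ_independent_of_hodgeModel_holds cmAbelianVarietyEigenbasisRealised_holds) Literature.NumberTheory.Transcendental.arapura2012_cor_15_4_6_holds V (I V (repAt a₀) (muLiu ι₁ GramClass.rep)) (line V (repAt a₀) (muLiu ι₁ GramClass.rep)))).H)) :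
    Summit.HodgeConjecture.HodgeConjecture.Theses.HCCMUnconditional.H413 :=
  HJ3aOfFourLetters.H413_of_four_letters hE1 hE1'h hE2' (F0P3HolProjectionOfF2.holCotFormSpectralProjection_of_F2 hF2) hdictE hocc

end Summit.HodgeConjecture.HodgeConjecture.Cruxes.H413.HJ3aOfThreeLettersF2

end
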